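import Summits.Ventures.CertifiedManyBodySolver.Downfold.PressureAxis
import HarnessLib

/-!
# Entry monotonicity of the manifold-width ratio (§P.12(e′-R3c) and §P.12(c′)(iii)-BY-GUARD-R3c)

Venture CertifiedManyBodySolver, cell `pub/hubbard-downfold` (S1 = ROUTER), seat hubbard-downfold-mod-2;
namespace `Summit.Ventures.CertifiedManyBodySolver.Downfold.Inflation`. Companion of
`Downfold.PressureAxis` / `Downfold.PressureAxisEdges` (`router/INFLATION-RULES.md` §P.12, rule
version v0.3.45; the lead's RULING R-cm 2026-08-27T08:46:32Z dated both readings).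

The router's third-branch ratio arm (ROUTER v0.6.4 §3 R3c) reads `r_man = U / W_man` against a
threshold `θ` (`θ_c3 = 0.6`), where `W_man` is the hull of two members and member (a) is the ENERGY
SPAN of the set of bands crossing the Fermi level: `span S = max_{i ∈ S} top i − min_{i ∈ S} bot i`.
Between two computed pressures the crossing SET may change. §1 proves the purely order-theoretic
fact the (e′-R3c) reading rests on: **the span is monotone in the set** (`bandSpan_mono`) — a band
ENTERING the crossing set (superset) can only enlarge member (a). §2 turns it into the ratio
statement: with `U ≥ 0` the ratio `U / W` is antitone in `W` (Mathlib `div_le_div_of_nonneg_left`), so a ratio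
DECIDED below `θ` at the smaller width stays decided at any larger width
(`decided_of_width_le`, `decided_of_superset`), also through the hull-with-a-fixed-member form
`U / min W_a W_b` (`decided_min_of_width_le`). §3 is the interval composition used on the bus: if
along `u ∈ [a, b]` the crossing set only GROWS from its value at `a` (entries only), the fixed-set
span does not fall below its value at `a` (the sign-definite transport premise of §P.12(a), an
INPUT here), and the ratio is decided at `a` on that span, then it is decided at every `u`
(`decided_on_Icc_of_entries`). An EXIT (the set shrinking) is NOT covered — exactly the case the
rule sends back to the band-edge certificate of `PressureAxisEdges` (e″) — or, for a STRADDLE word, to the one-number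
post-exit certificate of §4 (lead RULING R-gb 2026-08-27: the R-cm (ε) print).

Everything is PROVED (finite lattice facts + ordered-field division). WHAT THIS IS NOT: a claim
that any material's crossing set is nested, that `U` is pressure-flat, or that member (a) is the
operative member — those are SCREENING-GRADE readings of the runners' records; the file fixes only
what follows from them.
-/

open Set

namespace Summit.Ventures.CertifiedManyBodySolver.Downfold.Inflation

/-! ## §1 The energy span of a band set is monotone in the set -/

/-- Energy span (hull width) of a nonempty finite set `s` of bands with band bottoms `bot` and band
tops `top`: `max_{i ∈ s} top i − min_{i ∈ s} bot i` — the router's `W_man` member (a) when `s` is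
the set of bands crossing `E_F` (ROUTER A8; INFLATION-RULES §P.12(e′-R3c)). -/
noncomputable def bandSpan {ι : Type*} (s : Finset ι) (hs : s.Nonempty) (bot top : ι → ℝ) : ℝ :=
  s.sup' hs top - s.inf' hs bot

/-- **Entry monotonicity of member (a).** A superset of bands spans at least as much energy:
`s ⊆ t ⇒ bandSpan s ≤ bandSpan t` (the maximum of the tops can only rise, the minimum of the
bottoms can only fall). This is the order-theoretic core of §P.12(e′-R3c): a band ENTERING the
crossing set cannot shrink `W_man`'s member (a). -/
theorem bandSpan_mono {ι : Type*} {s t : Finset ι} (hs : s.Nonempty) (hst : s ⊆ t)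
    (bot top : ι → ℝ) : bandSpan s hs bot top ≤ bandSpan t (hs.mono hst) bot top := by
  unfold bandSpan
  have h1 : s.sup' hs top ≤ t.sup' (hs.mono hst) top :=
    Finset.sup'_le hs top (fun b hb => Finset.le_sup' top (hst hb))
  have h2 : t.inf' (hs.mono hst) bot ≤ s.inf' hs bot :=
    Finset.le_inf' hs bot (fun b hb => Finset.inf'_le bot (hst hb))
  linarith

/-- The span of a set containing a band `i` is at least that band's own width `top i − bot i`
(so it is positive as soon as one member band has positive width). -/
theorem width_le_bandSpan {ι : Type*} {s : Finset ι} {i : ι} (hi : i ∈ s) (bot top : ι → ℝ) :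
    top i - bot i ≤ bandSpan s ⟨i, hi⟩ bot top := by
  unfold bandSpan
  have h1 : top i ≤ s.sup' ⟨i, hi⟩ top := Finset.le_sup' top hi
  have h2 : s.inf' ⟨i, hi⟩ bot ≤ bot i := Finset.inf'_le bot hi
  linarith

/-! ## §2 The ratio `U / W` is antitone in the width; decided stays decided -/

/-- **Decided stays decided under widening.** With `U ≥ 0` and `0 < W₁ ≤ W₂` the ratio can only
fall (`U / W₂ ≤ U / W₁`, Mathlib `div_le_div_of_nonneg_left`); hence if `U / W₁ < θ` (the R3c ratio
arm decided below its threshold at width `W₁`) then `U / W₂ < θ`. -/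
theorem decided_of_width_le {U W₁ W₂ θ : ℝ} (hU : 0 ≤ U) (hW₁ : 0 < W₁) (h : W₁ ≤ W₂)
    (hdec : U / W₁ < θ) : U / W₂ < θ :=
  lt_of_le_of_lt (div_le_div_of_nonneg_left hU hW₁ h) hdec

/-- The same through the A8 hull form `W_man,lo = min (member a) (member b)` with member (b) fixed:
widening member (a) from `Wa` to `Wa'` cannot un-decide `U / min Wa Wb < θ`. -/
theorem decided_min_of_width_le {U Wa Wa' Wb θ : ℝ} (hU : 0 ≤ U) (hWa : 0 < Wa) (hWb : 0 < Wb)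
    (h : Wa ≤ Wa') (hdec : U / min Wa Wb < θ) : U / min Wa' Wb < θ := by
  have hmin : 0 < min Wa Wb := lt_min hWa hWb
  have hle : min Wa Wb ≤ min Wa' Wb := min_le_min h le_rfl
  exact decided_of_width_le hU hmin hle hdec

/-- **(e′-R3c) at one pressure.** If the crossing set `s` is contained in `t` (entries only), the
span of `s` is positive, and the ratio is decided below `θ` on the span of `s`, then it is decided
on the span of `t`. -/
theorem decided_of_superset {ι : Type*} {s t : Finset ι} (hs : s.Nonempty) (hst : s ⊆ t)
    (bot top : ι → ℝ) {U θ : ℝ} (hU : 0 ≤ U) (hpos : 0 < bandSpan s hs bot top)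
    (hdec : U / bandSpan s hs bot top < θ) : U / bandSpan t (hs.mono hst) bot top < θ :=
  decided_of_width_le hU hpos (bandSpan_mono hs hst bot top) hdec

/-! ## §3 Along a pressure interval: entries only + non-falling fixed-set span ⇒ decided throughout -/

/-- **(e′-R3c) / (c′)(iii)-BY-GUARD-R3c on `[a, b]`.** Along the axis `u` (pressure, volume or
`log V` — parametrisation-free) let `S u` be the crossing set and `bot u`, `top u` the band-edge
functions. Hypotheses: (1) ENTRIES ONLY — `S a ⊆ S u` for every `u ∈ [a, b]`; (2) the span of the
FIXED set `S a` does not fall below its value at `a` along the interval (the sign-definite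
transport premise of §P.12(a)/(g): manifold widths rise under compression — an input read off the
records, not proved here); (3) at `a` that span is positive and the ratio is decided, `U / span < θ`
(for the one-sided use, `θ`-margin already consumed by the `U` pad is the caller's business: pass the
padded `U`). Conclusion: the ratio on the actual crossing set is decided below `θ` at every
`u ∈ [a, b]`. An EXIT (`S u ⊉ S a`) violates (1) and is not covered. -/
theorem decided_on_Icc_of_entries {ι : Type*} {a b : ℝ} (S : ℝ → Finset ι)
    (bot top : ℝ → ι → ℝ) (hSa : (S a).Nonempty)
    (hnest : ∀ u ∈ Icc a b, S a ⊆ S u)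
    (hrise : ∀ u ∈ Icc a b, bandSpan (S a) hSa (bot a) (top a) ≤ bandSpan (S a) hSa (bot u) (top u))
    {U θ : ℝ} (hU : 0 ≤ U) (hpos : 0 < bandSpan (S a) hSa (bot a) (top a))
    (hdec : U / bandSpan (S a) hSa (bot a) (top a) < θ) :
    ∀ u, ∀ hu : u ∈ Icc a b, U / bandSpan (S u) (hSa.mono (hnest u hu)) (bot u) (top u) < θ := by
  intro u hu
  -- step 1: transport the fixed set `S a` from `a` to `u` (width does not fall)
  have hpos_u : 0 < bandSpan (S a) hSa (bot u) (top u) := lt_of_lt_of_le hpos (hrise u hu)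
  have hdec_u : U / bandSpan (S a) hSa (bot u) (top u) < θ :=
    decided_of_width_le hU hpos (hrise u hu) hdec
  -- step 2: enlarge the set from `S a` to `S u` at `u` (entries only)
  exact decided_of_superset hSa (hnest u hu) (bot u) (top u) hU hpos_u hdec_u

/-- **An exit is not covered (the bound is not vacuous).** Two bands with edges `bot = (0, 0)`,
`top = (1, 3)`: the set `{0, 1}` spans `3`, the subset `{0}` (band `1` has EXITED) spans `1`; with
`U = 1.2`, `θ = 0.6` the ratio is decided on the full set (`0.4 < 0.6`) but NOT on the subset
(`1.2 ≥ 0.6`). This is why (e′-R3c) sends exits back to the band-edge certificate (e″). -/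
theorem exists_exit_undecides :
    ∃ (bot top : Fin 2 → ℝ) (U θ : ℝ) (hs : ({0} : Finset (Fin 2)).Nonempty)
      (ht : ({0, 1} : Finset (Fin 2)).Nonempty),
      ({0} : Finset (Fin 2)) ⊆ {0, 1} ∧ 0 ≤ U ∧ U / bandSpan {0, 1} ht bot top < θ ∧
        ¬ U / bandSpan {0} hs bot top < θ := by
  refine ⟨![0, 0], ![1, 3], 1.2, 0.6, ⟨0, by simp⟩, ⟨0, by simp⟩, by simp, by norm_num, ?_, ?_⟩
  · have h : bandSpan ({0, 1} : Finset (Fin 2)) ⟨0, by simp⟩ ![0, 0] ![1, 3] = 3 := by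
      norm_num [bandSpan, Finset.sup'_insert, Finset.inf'_insert]
    rw [h]; norm_num
  · have h : bandSpan ({0} : Finset (Fin 2)) ⟨0, by simp⟩ ![0, 0] ![1, 3] = 1 := by
      norm_num [bandSpan]
    rw [h]; norm_num

/-! ## §4 An EXIT certified by the post-exit print (lead RULING R-gb 2026-08-27T15:05:10Z; the
R-cm (ε) device)

For a STRADDLE word (`r_lo < θ ≤ r_hi`: «UND:MIXED») the crossing set may LOSE a band between two
columns (NbSe₂ (0,10): `[24, 25, 26] → [25, 26]`). An exit can only SHRINK member (a), hence only
RAISE both ratio ends: the high arm `θ ≤ r_hi` survives automatically, the low arm `r_lo < θ` does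
not — it needs ONE number, the post-exit `r_lo` at the low-pressure record (the runner's zero-DFT
(ε) print: `W_man` on the post-exit set only). With it the straddle holds for BOTH candidate sets,
and a word that is the same for both candidates is constant along the interval whatever the exit
pressure. -/

/-- **Ratio ends under a width DECREASE** (an exit shrinks the span): with `U_hi ≥ 0` and
`0 < W' ≤ W`, `θ ≤ U_hi / W` ⇒ `θ ≤ U_hi / W'` — the high arm of a straddle survives an exit by
itself. [folklore] -/
theorem straddle_hi_of_width_ge {U_hi W W' θ : ℝ} (hU : 0 ≤ U_hi) (hW' : 0 < W') (h : W' ≤ W)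
    (hhi : θ ≤ U_hi / W) : θ ≤ U_hi / W' :=
  hhi.trans (div_le_div_of_nonneg_left hU hW' h)

/-- **The (ε) certificate**: high arm at the pre-exit width `W` plus the ONE printed post-exit number
`U_lo / W' < θ` ⇒ the straddle `U_lo / W' < θ ≤ U_hi / W'` holds on the post-exit set too.
[folklore] -/
theorem straddle_after_exit {U_lo U_hi W W' θ : ℝ} (hU : 0 ≤ U_hi) (hW' : 0 < W') (h : W' ≤ W)
    (hhi : θ ≤ U_hi / W) (hlo' : U_lo / W' < θ) : U_lo / W' < θ ∧ θ ≤ U_hi / W' :=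
  ⟨hlo', straddle_hi_of_width_ge hU hW' h hhi⟩

/-- The exit as a SUBSET: if the post-exit set `s'` is a nonempty subset of the pre-exit set `s`,
its span is at most the pre-exit span (`bandSpan_mono`), so `straddle_after_exit` applies with
`W' = span s'`, `W = span s`. [folklore] -/
theorem straddle_after_exit_sets {ι : Type*} {s s' : Finset ι} (hs' : s'.Nonempty) (hsub : s' ⊆ s)
    (bot top : ι → ℝ) {U_lo U_hi θ : ℝ} (hU : 0 ≤ U_hi) (hpos : 0 < bandSpan s' hs' bot top)
    (hhi : θ ≤ U_hi / bandSpan s (hs'.mono hsub) bot top)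
    (hlo' : U_lo / bandSpan s' hs' bot top < θ) :
    U_lo / bandSpan s' hs' bot top < θ ∧ θ ≤ U_hi / bandSpan s' hs' bot top :=
  straddle_after_exit hU hpos (bandSpan_mono hs' hsub bot top) hhi hlo'

/-- **Two candidate sets, one word ⇒ the word is constant along the interval.** If at every
`u ∈ [a, b]` the crossing set is one of two candidates `S`, `S'` (before / after the exit, the exit
pressure unknown) and the router word computed on each candidate is the same `w`, the word is `w`
at every `u`. [folklore] -/
theorem word_eq_of_two_candidates {α β : Type*} {a b : ℝ} (Sof : ℝ → α) (word : α → β)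
    {S S' : α} {w : β} (hrange : ∀ u ∈ Icc a b, Sof u = S ∨ Sof u = S') (hS : word S = w)
    (hS' : word S' = w) : ∀ u ∈ Icc a b, word (Sof u) = w := by
  intro u hu
  rcases hrange u hu with h | h <;> rw [h] <;> assumption

end Summit.Ventures.CertifiedManyBodySolver.Downfold.Inflation
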